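import Summits.QuantumFields.YangMills.Theorems.BalabanLadderIRcofEquipartitionSeamSliceKernelAlgebra
import HarnessLib

/-!
# Crux `IRcof` (stmt-QuantumFields-26930) · line `equipartition_seam` (row 47) · located stub L `SpectralDict.SliceRealisationV` — helper:
# the gauge-averaged SLICE KERNEL of a GENERAL weight, F2a ∕ 7 — §4 general bounds (no normalisation of `w`) and the SANDWICHED slice kernel `sandKernel a` with the eight structural conjuncts `slicePackage` of `SliceRealisationV`

SOURCE OF RECORD: `Cruxes/IRcof/Lines/equipartition_seam_SliceKernel.lean` rev 9 (crux write 148dcb46cebb, 2172 l.; author ideator ym-ir-idea-22 g7; critic ym-ir-crit-3 g5 TYPEREADs CLEAN of revs 1–6 (bus l.1748 ∕ 1758 ∕ 1768 ∕ 1775 ∕ 1780), placement ruling H1 ∕ H2 (l.1748: §1 → Literature = lit-4 L34 p694639; §2 onward → ≤ 400-line Theorems files) — split VERBATIM along its §§ by LEAD prover ym-ir-line-ab-p1 g8 on the ideator's LAND-ASK H2 (bus l.1786 ∕ l.1789: files F1–F7, each importing the previous).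

HONEST FRAMING.  Elementary measure theory ∕ Fubini on compact groups (Lüscher 1977 ∕ Osterwalder–Seiler 1978 transfer-matrix positivity, weight-generic); proves NO located stub of row 47 by itself (S1, S3ʷ, T, L, N, S5ᵛ open); row 47 class PWP, mechanism 0, width 0; `IRcof` ∕ `IR` 0∕1; the Yang–Mills mass gap (Clay) is NOT proved by anything in this tree; R4 closes only the conditional finite-𝕋⁴ rung `BalabanLadder.UV`.
-/

noncomputable section

open MeasureTheory ProbabilityTheory Finset Filter Function
open scoped BigOperators

namespace Summit.QuantumFields.YangMills.Cruxes.IRcof.EquipartitionSeam.SliceKernel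

open Literature.Analysis.Matrix (IsPosDefKernel isPosDefKernel_const IsPosDefKernel.integral_prod_nonneg_of_measurable)
open Literature.MathematicalPhysics.QuantumFieldTheory (haarProbability integral_integral_fibreAverage_nonneg
  integrable_of_abs_le_one abs_mul_mul_le_one abs_integral_le_one)


/-! ### §4 General bounds (no normalisation of `w`), and the SANDWICHED slice kernel `a(V) k(V,V') a(V')`
with a twist-invariant spatial factor `a` — the eight structural conjuncts of `SliceRealisationV` -/

section Package

open Literature.MathematicalPhysics.QuantumFieldTheory.WilsonGauge (measurePreserving_mul_mul)

variable {P Λ H : Type*} [Fintype P] [Fintype Λ] [Group H] [TopologicalSpace H] [IsTopologicalGroup H]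
  [CompactSpace H] [MeasurableSpace H] [BorelSpace H] (src tgt : Λ → P) (w : H → ℝ)

omit [Fintype P] [TopologicalSpace H] [IsTopologicalGroup H] [CompactSpace H] [MeasurableSpace H] [BorelSpace H] in
/-- Auxiliary `tempKernel_const_mul` of the slice-kernel port (its statement is its type; rôle explained in the module ∕ section docstrings). -/
theorem tempKernel_const_mul (r : ℝ) (V : Λ → H) (g : P → H) (V' : Λ → H) :
    tempKernel src tgt (fun h => r * w h) V g V' = r ^ Fintype.card Λ * tempKernel src tgt w V g V' := by
  unfold tempKernel
  rw [Finset.prod_mul_distrib, Finset.prod_const, Finset.card_univ]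

/-- Auxiliary `avgKernel_const_mul` of the slice-kernel port (its statement is its type; rôle explained in the module ∕ section docstrings). -/
theorem avgKernel_const_mul (r : ℝ) (V V' : Λ → H) :
    avgKernel src tgt (fun h => r * w h) V V' = r ^ Fintype.card Λ * avgKernel src tgt w V V' := by
  unfold avgKernel
  simp_rw [tempKernel_const_mul src tgt w r]
  exact integral_const_mul _ _

/-- Auxiliary `abs_avgKernel_le` of the slice-kernel port (its statement is its type; rôle explained in the module ∕ section docstrings). -/
theorem abs_avgKernel_le (hw0 : ∀ h, 0 ≤ w h) {Cw : ℝ} (hwC : ∀ h, w h ≤ Cw) (V V' : Λ → H) :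
    |avgKernel src tgt w V V'| ≤ Cw ^ Fintype.card Λ := by
  rw [abs_of_nonneg (avgKernel_nonneg src tgt w hw0 V V')]
  unfold avgKernel
  have hb : ∀ g : P → H, tempKernel src tgt w V g V' ≤ Cw ^ Fintype.card Λ := fun g => by
    unfold tempKernel
    calc ∏ l, w ((V l)⁻¹ * g (src l) * V' l * (g (tgt l))⁻¹) ≤ ∏ _l : Λ, Cw :=
          Finset.prod_le_prod (fun l _ => hw0 _) fun l _ => hwC _
      _ = Cw ^ Fintype.card Λ := by rw [Finset.prod_const, Finset.card_univ]
  calc ∫ g, tempKernel src tgt w V g V' ∂(Measure.pi fun _ : P => haarProbability H)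
      ≤ ∫ _g, Cw ^ Fintype.card Λ ∂(Measure.pi fun _ : P => haarProbability H) := by
        refine integral_mono_of_nonneg (Eventually.of_forall fun g => tempKernel_nonneg src tgt w hw0 V g V')
          (integrable_const _) (Eventually.of_forall hb)
    _ = Cw ^ Fintype.card Λ := by simp

variable [SecondCountableTopology H]

/-- **Lüscher positivity, general bounds**: as `posType_avgKernel`, for `0 ≤ w ≤ C_w` and `|φ| ≤ C_φ` (reduce to the
normalised case by scaling `w` and `φ`; `max · 1` avoids the degenerate constants). [cite: Luscher1977] -/
theorem posType_avgKernel_of_le (hw : Continuous w) (hw0 : ∀ h, 0 ≤ w h) {Cw : ℝ} (hwC : ∀ h, w h ≤ Cw)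
    (hcl : ∀ g h, w (g * h * g⁻¹) = w h) (hpd : IsPosDefKernel fun x y : H => w (x⁻¹ * y))
    (φ : (Λ → H) → ℝ) (hφ : Measurable φ) {Cφ : ℝ} (hφC : ∀ V, |φ V| ≤ Cφ) :
    0 ≤ ∫ V, ∫ V', φ V * avgKernel src tgt w V V' * φ V'
      ∂(Measure.pi fun _ : Λ => haarProbability H) ∂(Measure.pi fun _ : Λ => haarProbability H) := by
  set r : ℝ := max Cw 1 with hr
  set s : ℝ := max Cφ 1 with hs
  have hr0 : 0 < r := lt_of_lt_of_le zero_lt_one (le_max_right _ _)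
  have hs0 : 0 < s := lt_of_lt_of_le zero_lt_one (le_max_right _ _)
  set w' : H → ℝ := fun h => r⁻¹ * w h with hw'
  set φ' : (Λ → H) → ℝ := fun V => s⁻¹ * φ V with hφ'
  have hw'c : Continuous w' := continuous_const.mul hw
  have hw'0 : ∀ h, 0 ≤ w' h := fun h => mul_nonneg (inv_nonneg.mpr hr0.le) (hw0 h)
  have hw'1 : ∀ h, w' h ≤ 1 := fun h => by
    rw [hw', inv_mul_le_iff₀ hr0, mul_one]; exact (hwC h).trans (le_max_left _ _)
  have hw'cl : ∀ g h, w' (g * h * g⁻¹) = w' h := fun g h => by simp only [hw', hcl]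
  have hw'pd : IsPosDefKernel fun x y : H => w' (x⁻¹ * y) := hpd.const_mul (inv_nonneg.mpr hr0.le)
  have hφ'm : Measurable φ' := measurable_const.mul hφ
  have hφ'1 : ∀ V, |φ' V| ≤ 1 := fun V => by
    rw [hφ', abs_mul, abs_inv, abs_of_pos hs0, inv_mul_le_iff₀ hs0, mul_one]
    exact (hφC V).trans (le_max_left _ _)
  have h := posType_avgKernel src tgt w' hw'c hw'0 hw'1 hw'cl hw'pd φ' hφ'm hφ'1
  have havg : ∀ V V', avgKernel src tgt w V V' = r ^ Fintype.card Λ * avgKernel src tgt w' V V' := fun V V' => by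
    rw [hw', avgKernel_const_mul src tgt w r⁻¹ V V', ← mul_assoc, ← mul_pow, mul_inv_cancel₀ hr0.ne', one_pow,
      one_mul]
  have hpt : ∀ V V', φ V * avgKernel src tgt w V V' * φ V' =
      (s * s * r ^ Fintype.card Λ) * (φ' V * avgKernel src tgt w' V V' * φ' V') := fun V V' => by
    rw [havg V V', hφ']
    field_simp
  simp_rw [hpt, integral_const_mul]
  exact mul_nonneg (by positivity) h

/-- **The sandwiched slice kernel** `K(V, V') = a(V) k(V, V') a(V')` (`a` = the spatial half-weight of a slice,
any bounded measurable twist-invariant function). -/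
def sandKernel (a : (Λ → H) → ℝ) (V V' : Λ → H) : ℝ := a V * avgKernel src tgt w V V' * a V'

variable (a : (Λ → H) → ℝ)

/-- Auxiliary `stronglyMeasurable_uncurry_sandKernel` of the slice-kernel port (its statement is its type; rôle explained in the module ∕ section docstrings). -/
theorem stronglyMeasurable_uncurry_sandKernel (hw : Continuous w) (ha : Measurable a) :
    StronglyMeasurable (uncurry (sandKernel src tgt w a)) := by
  have h1 : StronglyMeasurable fun z : (Λ → H) × (Λ → H) => a z.1 := (ha.comp measurable_fst).stronglyMeasurable
  have h2 : StronglyMeasurable fun z : (Λ → H) × (Λ → H) => a z.2 := (ha.comp measurable_snd).stronglyMeasurable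
  exact (h1.mul (stronglyMeasurable_uncurry_avgKernel src tgt w hw)).mul h2

omit [SecondCountableTopology H] in
/-- Auxiliary `norm_sandKernel_le` of the slice-kernel port (its statement is its type; rôle explained in the module ∕ section docstrings). -/
theorem norm_sandKernel_le (hw0 : ∀ h, 0 ≤ w h) {Cw : ℝ} (hwC : ∀ h, w h ≤ Cw) {Ca : ℝ} (haC : ∀ V, |a V| ≤ Ca)
    (V V' : Λ → H) : ‖sandKernel src tgt w a V V'‖ ≤ Ca * Cw ^ Fintype.card Λ * Ca := by
  have ha0 : 0 ≤ Ca := (abs_nonneg _).trans (haC V)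
  rw [Real.norm_eq_abs, sandKernel, abs_mul, abs_mul]
  exact mul_le_mul (mul_le_mul (haC V) (abs_avgKernel_le src tgt w hw0 hwC V V') (abs_nonneg _) ha0) (haC V')
    (abs_nonneg _) (mul_nonneg ha0 ((abs_nonneg _).trans (abs_avgKernel_le src tgt w hw0 hwC V V')))

/-- Auxiliary `sandKernel_symm` of the slice-kernel port (its statement is its type; rôle explained in the module ∕ section docstrings). -/
theorem sandKernel_symm (hw : Continuous w) (hinv : ∀ h, w h⁻¹ = w h) (hcl : ∀ g h, w (g * h * g⁻¹) = w h)
    (V V' : Λ → H) : sandKernel src tgt w a V V' = sandKernel src tgt w a V' V := by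
  rw [sandKernel, sandKernel, avgKernel_symm src tgt w hw hinv hcl V' V]; ring

/-- Positive type of the sandwiched kernel against bounded measurable real test functions (fold `a` into the test
function). [cite: Luscher1977] -/
theorem posType_sandKernel (hw : Continuous w) (hw0 : ∀ h, 0 ≤ w h) {Cw : ℝ} (hwC : ∀ h, w h ≤ Cw)
    (hcl : ∀ g h, w (g * h * g⁻¹) = w h) (hpd : IsPosDefKernel fun x y : H => w (x⁻¹ * y))
    (ha : Measurable a) {Ca : ℝ} (haC : ∀ V, |a V| ≤ Ca)
    (φ : (Λ → H) → ℝ) (hφ : Measurable φ) (hφ1 : ∀ V, |φ V| ≤ 1) :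
    0 ≤ ∫ V, ∫ V', φ V * sandKernel src tgt w a V V' * φ V'
      ∂(Measure.pi fun _ : Λ => haarProbability H) ∂(Measure.pi fun _ : Λ => haarProbability H) := by
  have hpt : ∀ V V', φ V * sandKernel src tgt w a V V' * φ V' =
      (φ V * a V) * avgKernel src tgt w V V' * (φ V' * a V') := fun V V' => by rw [sandKernel]; ring
  simp_rw [hpt]
  refine posType_avgKernel_of_le src tgt w hw hw0 hwC hcl hpd (fun V => φ V * a V) (hφ.mul ha) (Cφ := 1 * Ca)
    fun V => ?_
  rw [abs_mul]
  exact mul_le_mul (hφ1 V) (haC V) (abs_nonneg _) zero_le_one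

omit [SecondCountableTopology H] in
/-- Auxiliary `sandKernel_ctwist` of the slice-kernel port (its statement is its type; rôle explained in the module ∕ section docstrings). -/
theorem sandKernel_ctwist {c : Λ → H} (hc : ∀ l, c l ∈ Subgroup.center H) (haT : ∀ V, a (ctwist c V) = a V)
    (V V' : Λ → H) : sandKernel src tgt w a (ctwist c V) (ctwist c V') = sandKernel src tgt w a V V' := by
  rw [sandKernel, sandKernel, avgKernel_ctwist src tgt w hc, haT, haT]

omit [Fintype P] [Fintype Λ] [TopologicalSpace H] [IsTopologicalGroup H] [CompactSpace H] [MeasurableSpace H]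
  [BorelSpace H] [SecondCountableTopology H] in
/-- The seam operators `T e = ctwist (c e)` of a homomorphism `c : Γ →* (Λ → H)` form an action. -/
theorem ctwist_hom_one {Γ : Type*} [Group Γ] (c : Γ →* (Λ → H)) : ctwist (c 1) = id := by
  rw [map_one, ctwist_one]

omit [Fintype P] [Fintype Λ] [TopologicalSpace H] [IsTopologicalGroup H] [CompactSpace H] [MeasurableSpace H]
  [BorelSpace H] [SecondCountableTopology H] in
/-- Auxiliary `ctwist_hom_mul` of the slice-kernel port (its statement is its type; rôle explained in the module ∕ section docstrings). -/
theorem ctwist_hom_mul {Γ : Type*} [Group Γ] (c : Γ →* (Λ → H)) (e e' : Γ) :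
    ctwist (c (e * e')) = ctwist (c e) ∘ ctwist (c e') := by
  rw [map_mul, ctwist_mul]

/-- **PACKAGE: the eight structural conjuncts of `SliceRealisationV`** for the sandwiched gauge-averaged slice
kernel of a general weight and the seam operators of a central homomorphism `c : Γ →* (Λ → H)` — probability,
joint measurability, boundedness, symmetry, positive type (real bounded measurable test functions), measure
preservation, action laws, invariance.  What remains for the located stub are the two Fubini identities (Z), (W)
on the concrete torus and `CountablyGenerated`. -/
theorem slicePackage (hw : Continuous w) (hw0 : ∀ h, 0 ≤ w h) {Cw : ℝ} (hwC : ∀ h, w h ≤ Cw)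
    (hinv : ∀ h, w h⁻¹ = w h) (hcl : ∀ g h, w (g * h * g⁻¹) = w h)
    (hpd : IsPosDefKernel fun x y : H => w (x⁻¹ * y)) (ha : Measurable a) {Ca : ℝ} (haC : ∀ V, |a V| ≤ Ca)
    {Γ : Type*} [Group Γ] (c : Γ →* (Λ → H)) (hc : ∀ e l, c e l ∈ Subgroup.center H)
    (haT : ∀ e V, a (ctwist (c e) V) = a V) :
    IsProbabilityMeasure (Measure.pi fun _ : Λ => haarProbability H) ∧
    StronglyMeasurable (uncurry (sandKernel src tgt w a)) ∧
    (∀ V V', ‖sandKernel src tgt w a V V'‖ ≤ Ca * Cw ^ Fintype.card Λ * Ca) ∧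
    (∀ V V', sandKernel src tgt w a V V' = sandKernel src tgt w a V' V) ∧
    (∀ φ : (Λ → H) → ℝ, Measurable φ → (∀ V, |φ V| ≤ 1) →
      0 ≤ ∫ V, ∫ V', φ V * sandKernel src tgt w a V V' * φ V'
        ∂(Measure.pi fun _ : Λ => haarProbability H) ∂(Measure.pi fun _ : Λ => haarProbability H)) ∧
    (∀ e, MeasurePreserving (ctwist (c e)) (Measure.pi fun _ : Λ => haarProbability H)
      (Measure.pi fun _ : Λ => haarProbability H)) ∧
    ctwist (c 1) = id ∧ (∀ e e', ctwist (c (e * e')) = ctwist (c e) ∘ ctwist (c e')) ∧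
    (∀ e V V', sandKernel src tgt w a (ctwist (c e) V) (ctwist (c e) V') = sandKernel src tgt w a V V') :=
  ⟨inferInstance, stronglyMeasurable_uncurry_sandKernel src tgt w a hw ha,
    norm_sandKernel_le src tgt w a hw0 hwC haC, sandKernel_symm src tgt w a hw hinv hcl,
    posType_sandKernel src tgt w a hw hw0 hwC hcl hpd ha haC, fun e => measurePreserving_ctwist (c e),
    ctwist_hom_one c, ctwist_hom_mul c, fun e => sandKernel_ctwist src tgt w a (hc e) (haT e)⟩


omit [Fintype P] [Group H] [IsTopologicalGroup H] [CompactSpace H] in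
/-- Slices of a second-countable group are countably generated measurable spaces (the `CountablyGenerated X`
conjunct of `SliceRealisationV`). -/
theorem countablyGenerated_slice : MeasurableSpace.CountablyGenerated (Λ → H) := inferInstance

end Package

end Summit.QuantumFields.YangMills.Cruxes.IRcof.EquipartitionSeam.SliceKernel

end
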